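import Mathlib
import Literature.Geometry.Lorentzian.ReggeWheelerTortoise
import Literature.Geometry.Lorentzian.ReggeWheelerChannels
import Literature.Analysis.PDE.Wave1DExteriorEnergy
import Summits.FinalStateConjecture.FinalStateConjecture.Theorems.PhotonSphereChannelsFixedModeReduction

/-!
# Crux `UniformPhotonSphereChannelsR` (K1R, stmt-FinalStateConjecture-14074), line
# `crum-peeling-recessive-tower` — closing chain 3/3: near ∧ far ⇒ K1R (uniform glue by domain of
# dependence)

K1R follows from its two half-line versions with uniform constants (`ρ₀ = max`, `C = max`,
`c = min`).  The exterior region `{ρ + |t| < |x − xc|}` is the disjoint union of the far component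
`{xc + ρ + |t| < x}` and the near component `{x < xc − ρ − |t|}`; the kernel `rwKernel` on the
two-component cone is the product of the one-sided kernels (glue `p = if x ≤ xc then p_near else
p_far`, `C²`, a solution and `t`-polynomial on each OPEN component), so the two-sided deficit is at
most the sum of the one-sided ones; the exterior energy is `E_far + E_near`, each monotone in `|t|`
(finite speed of propagation, `Literature.Analysis.PDE.wave1D_{far,near}Energy_mono_*`), so
`liminf E_far + liminf E_near ≤ liminf E_ext` at `±∞`.  This is the uniform-constant version of the
landed per-mode `Theorems.fixedModeChannels_of_near_far`; statement and proof are the line's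
skeleton v4 §4 (`uniform_of_near_far`, lead-0), with the two hypotheses spelled out (the skeleton's
`NearLogEdgeChannels`, `FarLogEdgeChannels`) and the conclusion = the BODY of the route decl
`Theses.PhotonSphereChannels.UniformPhotonSphereChannelsR`.  No stub enters here.
-/

-- `Summit.<S>.<S>` repeats a namespace component by design (D-0017); off here as in the lakefile.
set_option linter.dupNamespace false

noncomputable section

namespace Summit.FinalStateConjecture.FinalStateConjecture.Theorems.UniformRClosing

open Literature.Geometry.Lorentzian Literature.Geometry.Lorentzian.ReggeWheeler
open Summit.FinalStateConjecture.FinalStateConjecture.Theorems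
open Literature.Analysis.PDE
open MeasureTheory Filter Set Topology
open scoped ENNReal

/-- Nonnegativity of `log(ℓ+1)` (local copy for this glue file). -/
theorem log_succ_nonneg' (ℓ : ℕ) : 0 ≤ Real.log ((ℓ : ℝ) + 1) := by
  apply Real.log_nonneg
  have : (0 : ℝ) ≤ ℓ := Nat.cast_nonneg ℓ
  linarith

/-- A threshold `ρ₀ + C log(ℓ+1) ≤ ρ` survives shrinking `ρ₀` and `C` (local copy). -/
theorem threshold_mono' {ρ₀ ρ₀' C C' ρ : ℝ} {ℓ : ℕ} (hρ : ρ₀ ≤ ρ₀') (hC : C ≤ C')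
    (h : ρ₀' + C' * Real.log ((ℓ : ℝ) + 1) ≤ ρ) : ρ₀ + C * Real.log ((ℓ : ℝ) + 1) ≤ ρ := by
  have := mul_le_mul_of_nonneg_right hC (log_succ_nonneg' ℓ)
  linarith

/-- **K1R follows from its two half-line versions with uniform constants** (`ρ₀ = max`,
`C = max`, `c = min`).  The exterior region `{ρ + |t| < |x − xc|}` is the disjoint union of the far
component `{xc + ρ + |t| < x}` and the near component `{x < xc − ρ − |t|}`; the kernel `rwKernel`
on the two-component cone is the product of the one-sided kernels (glue `p = if x ≤ xc then p_near
else p_far`, `C²`, a solution and `t`-polynomial on each OPEN component), so the two-sided deficit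
is at most the sum of the one-sided ones; the exterior energy is `E_far + E_near`, each monotone in
`|t|` (finite speed of propagation, `Literature.Analysis.PDE.wave1D_{far,near}Energy_mono_*`), so
`liminf E_far + liminf E_near ≤ liminf E_ext` at `±∞`.  (Uniform-constant version of the landed
per-mode `Theorems.fixedModeChannels_of_near_far`, whose witnesses are hidden in `∃` and cannot be
reused; same proof.) -/
theorem uniform_of_near_far
    (hnear :
      ∀ M : ℝ, 0 < M → ∃ ρ₀ : ℝ, 0 ≤ ρ₀ ∧ ∃ C : ℝ, 0 ≤ C ∧ ∃ c : ℝ, 0 < c ∧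
        ∀ (r : ℝ → ℝ) (xc : ℝ), IsTortoiseRadius M r xc → ∀ (s ℓ : ℕ), s ≤ 2 → s ≤ ℓ →
          ∀ ρ : ℝ, ρ₀ + C * Real.log ((ℓ : ℝ) + 1) ≤ ρ →
            ∀ ψ : ℝ → ℝ → ℝ, IsRWSolution M s ℓ r ψ →
              ENNReal.ofReal c *
                  (⨅ p ∈ {p : ℝ → ℝ → ℝ |
                      IsSolutionOn (linePotential M s ℓ r) p {z : ℝ × ℝ | z.2 < xc - ρ - |z.1|} ∧
                        IsPolynomialInTimeOn p {z : ℝ × ℝ | z.2 < xc - ρ - |z.1|}},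
                    ∫⁻ x in Set.Iio (xc - ρ), ENNReal.ofReal
                      (energyDensity (linePotential M s ℓ r) (fun t y => ψ t y - p t y) 0 x))
                ≤ liminf (fun t => ∫⁻ x in Set.Iio (xc - ρ - |t|),
                      ENNReal.ofReal (energyDensity (linePotential M s ℓ r) ψ t x)) atTop
                  + liminf (fun t => ∫⁻ x in Set.Iio (xc - ρ - |t|),
                      ENNReal.ofReal (energyDensity (linePotential M s ℓ r) ψ t x)) atBot)
    (hfar :
      ∀ M : ℝ, 0 < M → ∃ ρ₀ : ℝ, 0 ≤ ρ₀ ∧ ∃ C : ℝ, 0 ≤ C ∧ ∃ c : ℝ, 0 < c ∧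
        ∀ (r : ℝ → ℝ) (xc : ℝ), IsTortoiseRadius M r xc → ∀ (s ℓ : ℕ), s ≤ 2 → s ≤ ℓ →
          ∀ ρ : ℝ, ρ₀ + C * Real.log ((ℓ : ℝ) + 1) ≤ ρ →
            ∀ ψ : ℝ → ℝ → ℝ, IsRWSolution M s ℓ r ψ →
              ENNReal.ofReal c *
                  (⨅ p ∈ {p : ℝ → ℝ → ℝ |
                      IsSolutionOn (linePotential M s ℓ r) p {z : ℝ × ℝ | xc + ρ + |z.1| < z.2} ∧
                        IsPolynomialInTimeOn p {z : ℝ × ℝ | xc + ρ + |z.1| < z.2}},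
                    ∫⁻ x in Set.Ioi (xc + ρ), ENNReal.ofReal
                      (energyDensity (linePotential M s ℓ r) (fun t y => ψ t y - p t y) 0 x))
                ≤ farChannelEnergy (linePotential M s ℓ r) (xc + ρ) ψ atTop
                  + farChannelEnergy (linePotential M s ℓ r) (xc + ρ) ψ atBot) :
    ∀ M : ℝ, 0 < M → ∃ ρ₀ : ℝ, 0 ≤ ρ₀ ∧ ∃ C : ℝ, 0 ≤ C ∧ ∃ c : ℝ, 0 < c ∧
      ∀ (r : ℝ → ℝ) (xc : ℝ), IsTortoiseRadius M r xc → ∀ (s ℓ : ℕ), s ≤ 2 → s ≤ ℓ →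
        ∀ ρ : ℝ, ρ₀ + C * Real.log ((ℓ : ℝ) + 1) ≤ ρ →
          ChannelInequality (linePotential M s ℓ r) xc ρ c := by
  intro M hM
  obtain ⟨ρn, hρn0, Cn, hCn0, cn, hcn, Hn⟩ := hnear M hM
  obtain ⟨ρf, hρf0, Cf, hCf0, cf, hcf, Hf⟩ := hfar M hM
  refine ⟨max ρn ρf, hρn0.trans (le_max_left _ _), max Cn Cf, hCn0.trans (le_max_left _ _),
    min cn cf, lt_min hcn hcf, ?_⟩
  intro r xc hr s ℓ hs hsℓ ρ hρ ψ hψ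
  have hρn : ρn + Cn * Real.log ((ℓ : ℝ) + 1) ≤ ρ :=
    threshold_mono' (le_max_left _ _) (le_max_left _ _) hρ
  have hρf : ρf + Cf * Real.log ((ℓ : ℝ) + 1) ≤ ρ :=
    threshold_mono' (le_max_right _ _) (le_max_right _ _) hρ
  have hρ0 : 0 ≤ ρ := by
    have := mul_nonneg hCn0 (log_succ_nonneg' ℓ)
    linarith
  set V : ℝ → ℝ := linePotential M s ℓ r with hVdef
  -- the potential: continuity and sign; the solution
  have hVc : Continuous V := continuous_linePotential s ℓ hr.continuous fun x => (hr.pos x).ne'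
  have hV0 : ∀ x, 0 ≤ V x := linePotential_nonneg hr.mass_pos.le hsℓ hr.two_mul_lt
  have hψ2 : ContDiff ℝ 2 (Function.uncurry ψ) := hψ.1
  have hsol' : ∀ t x, iteratedDeriv 2 (fun τ => ψ τ x) t - iteratedDeriv 2 (ψ t) x
      + V x * ψ t x = 0 := fun t x => hψ.2 (t, x)
  -- one-sided energies, kernels and initial deviations
  set Ef : ℝ → ℝ≥0∞ := fun t => ∫⁻ x in Ioi (xc + ρ + |t|), ENNReal.ofReal (energyDensity V ψ t x)
    with hEf
  set En : ℝ → ℝ≥0∞ := fun t => ∫⁻ x in Iio (xc - ρ - |t|), ENNReal.ofReal (energyDensity V ψ t x)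
    with hEn
  set Ωf : Set (ℝ × ℝ) := {z | xc + ρ + |z.1| < z.2} with hΩf
  set Ωn : Set (ℝ × ℝ) := {z | z.2 < xc - ρ - |z.1|} with hΩn
  set Pf : Set (ℝ → ℝ → ℝ) := {p | IsSolutionOn V p Ωf ∧ IsPolynomialInTimeOn p Ωf} with hPf
  set Pn : Set (ℝ → ℝ → ℝ) := {p | IsSolutionOn V p Ωn ∧ IsPolynomialInTimeOn p Ωn} with hPn
  set If : (ℝ → ℝ → ℝ) → ℝ≥0∞ := fun p =>
    ∫⁻ x in Ioi (xc + ρ), ENNReal.ofReal (energyDensity V (fun t y => ψ t y - p t y) 0 x) with hIf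
  set In : (ℝ → ℝ → ℝ) → ℝ≥0∞ := fun p =>
    ∫⁻ x in Iio (xc - ρ), ENNReal.ofReal (energyDensity V (fun t y => ψ t y - p t y) 0 x) with hIn
  set I : (ℝ → ℝ → ℝ) → ℝ≥0∞ := fun p =>
    ∫⁻ x in {x : ℝ | ρ < |x - xc|}, ENNReal.ofReal (energyDensity V (fun t y => ψ t y - p t y) 0 x)
    with hI
  have HF : ENNReal.ofReal cf * (⨅ p ∈ Pf, If p) ≤ liminf Ef atTop + liminf Ef atBot :=
    Hf r xc hr s ℓ hs hsℓ ρ hρf ψ hψ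
  have HN : ENNReal.ofReal cn * (⨅ p ∈ Pn, In p) ≤ liminf En atTop + liminf En atBot :=
    Hn r xc hr s ℓ hs hsℓ ρ hρn ψ hψ
  -- (A) monotonicity of the one-sided energies (finite speed of propagation)
  have hEf_anti : AntitoneOn Ef (Ici 0) := fun a ha b _ hab =>
    wave1D_farEnergy_mono_of_nonneg (V := V) hVc hV0 hψ2 hsol' (xc + ρ) ha hab
  have hEf_mono : MonotoneOn Ef (Iic 0) := fun a _ b hb hab =>
    wave1D_farEnergy_mono_of_nonpos (V := V) hVc hV0 hψ2 hsol' (xc + ρ) hb hab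
  have hEn_anti : AntitoneOn En (Ici 0) := fun a ha b _ hab =>
    wave1D_nearEnergy_mono_of_nonneg (V := V) hVc hV0 hψ2 hsol' (xc - ρ) ha hab
  have hEn_mono : MonotoneOn En (Iic 0) := fun a _ b hb hab =>
    wave1D_nearEnergy_mono_of_nonpos (V := V) hVc hV0 hψ2 hsol' (xc - ρ) hb hab
  -- (B) the exterior region splits into the two components
  have hsplit : ∀ u : ℝ, 0 ≤ u →
      {x : ℝ | u < |x - xc|} = Ioi (xc + u) ∪ Iio (xc - u) := by
    intro u hu
    ext x
    simp only [mem_setOf_eq, mem_union, mem_Ioi, mem_Iio]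
    constructor
    · intro h
      rcases le_or_gt 0 (x - xc) with hx | hx
      · rw [abs_of_nonneg hx] at h; left; linarith
      · rw [abs_of_neg hx] at h; right; linarith
    · rintro (h | h)
      · exact lt_of_lt_of_le (by linarith) (le_abs_self _)
      · exact lt_of_lt_of_le (by linarith) (neg_le_abs _)
  have hdisj : ∀ u : ℝ, 0 ≤ u → Disjoint (Ioi (xc + u)) (Iio (xc - u)) := fun u hu =>
    Set.disjoint_left.2 fun x hx hx' => by
      simp only [mem_Ioi, mem_Iio] at hx hx'; linarith
  have hEext : exteriorEnergy V xc ρ ψ = fun t => Ef t + En t := by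
    funext t
    have hu : 0 ≤ ρ + |t| := add_nonneg hρ0 (abs_nonneg t)
    show (∫⁻ x in {x : ℝ | ρ + |t| < |x - xc|}, ENNReal.ofReal (energyDensity V ψ t x)) = Ef t + En t
    rw [hsplit _ hu, lintegral_union measurableSet_Iio (hdisj _ hu)]
    simp only [hEf, hEn, add_assoc, sub_sub]
  have htop : liminf Ef atTop + liminf En atTop ≤ liminf (exteriorEnergy V xc ρ ψ) atTop := by
    rw [hEext]; exact add_liminf_le_liminf_add_of_antitoneOn hEf_anti hEn_anti
  have hbot : liminf Ef atBot + liminf En atBot ≤ liminf (exteriorEnergy V xc ρ ψ) atBot := by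
    rw [hEext]; exact add_liminf_le_liminf_add_of_monotoneOn hEf_mono hEn_mono
  -- (C) the kernel is a product: glueing one-sided kernel elements
  have hΩf_open : IsOpen Ωf := isOpen_lt (by fun_prop) continuous_snd
  have hΩn_open : IsOpen Ωn := isOpen_lt continuous_snd (by fun_prop)
  have hfar_of_mem : ∀ z : ℝ × ℝ, z ∈ exteriorCone xc ρ → z ∈ Ωf ∨ z ∈ Ωn := by
    intro z hz
    have hz' : ρ + |z.1| < |z.2 - xc| := hz
    rcases le_or_gt 0 (z.2 - xc) with h | h
    · left; rw [abs_of_nonneg h] at hz'; show xc + ρ + |z.1| < z.2; linarith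
    · right; rw [abs_of_neg h] at hz'; show z.2 < xc - ρ - |z.1|; linarith
  have key : (⨅ p ∈ rwKernel V xc ρ, I p) ≤ (⨅ p ∈ Pf, If p) + (⨅ p ∈ Pn, In p) := by
    simp_rw [ENNReal.iInf_add, ENNReal.add_iInf]
    refine le_iInf fun pf => le_iInf fun hpf => le_iInf fun pn => le_iInf fun hpn => ?_
    obtain ⟨⟨hpf1, hpf2⟩, Nf, af, hpf3⟩ := hpf
    obtain ⟨⟨hpn1, hpn2⟩, Nn, an, hpn3⟩ := hpn
    set g : ℝ → ℝ → ℝ := fun t x => if x ≤ xc then pn t x else pf t x with hg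
    -- local agreement of the glued function with the pieces
    have hg_far : ∀ x, xc < x → ∀ t, g t x = pf t x := fun x hx t => by
      simp only [hg, if_neg (not_le.2 hx)]
    have hg_near : ∀ x, x < xc → ∀ t, g t x = pn t x := fun x hx t => by
      simp only [hg, if_pos hx.le]
    have hg_far_ev : ∀ t x, xc < x → (g t) =ᶠ[𝓝 x] (pf t) := fun t x hx =>
      (eventually_gt_nhds hx).mono fun y hy => hg_far y hy t
    have hg_near_ev : ∀ t x, x < xc → (g t) =ᶠ[𝓝 x] (pn t) := fun t x hx =>
      (eventually_lt_nhds hx).mono fun y hy => hg_near y hy t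
    have hxfar : ∀ z : ℝ × ℝ, z ∈ Ωf → xc < z.2 := fun z hz => by
      have h : xc + ρ + |z.1| < z.2 := hz
      linarith [abs_nonneg z.1]
    have hxnear : ∀ z : ℝ × ℝ, z ∈ Ωn → z.2 < xc := fun z hz => by
      have h : z.2 < xc - ρ - |z.1| := hz
      linarith [abs_nonneg z.1]
    have hgP : g ∈ rwKernel V xc ρ := by
      refine ⟨?_, ?_, ?_⟩
      · -- C² on the two-component cone
        intro z hz
        rcases hfar_of_mem z hz with hzf | hzn
        · have h1 : ContDiffAt ℝ 2 (Function.uncurry pf) z :=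
            hpf1.contDiffAt (hΩf_open.mem_nhds hzf)
          have h2 : Function.uncurry g =ᶠ[𝓝 z] Function.uncurry pf := by
            have : ∀ᶠ w : ℝ × ℝ in 𝓝 z, xc < w.2 :=
              (isOpen_lt continuous_const continuous_snd).mem_nhds (hxfar z hzf)
            exact this.mono fun w hw => hg_far w.2 hw w.1
          exact (h1.congr_of_eventuallyEq h2).contDiffWithinAt
        · have h1 : ContDiffAt ℝ 2 (Function.uncurry pn) z :=
            hpn1.contDiffAt (hΩn_open.mem_nhds hzn)
          have h2 : Function.uncurry g =ᶠ[𝓝 z] Function.uncurry pn := by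
            have : ∀ᶠ w : ℝ × ℝ in 𝓝 z, w.2 < xc :=
              (isOpen_lt continuous_snd continuous_const).mem_nhds (hxnear z hzn)
            exact this.mono fun w hw => hg_near w.2 hw w.1
          exact (h1.congr_of_eventuallyEq h2).contDiffWithinAt
      · -- a solution on the cone
        intro z hz
        rcases hfar_of_mem z hz with hzf | hzn
        · have hsolf : iteratedDeriv 2 (fun τ => pf τ z.2) z.1 - iteratedDeriv 2 (pf z.1) z.2
              + V z.2 * pf z.1 z.2 = 0 := hpf2 z hzf
          show iteratedDeriv 2 (fun τ => g τ z.2) z.1 - iteratedDeriv 2 (g z.1) z.2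
              + V z.2 * g z.1 z.2 = 0
          have e1 : (fun τ => g τ z.2) = fun τ => pf τ z.2 := funext (hg_far z.2 (hxfar z hzf))
          rw [e1, (hg_far_ev z.1 z.2 (hxfar z hzf)).iteratedDeriv_eq, hg_far z.2 (hxfar z hzf)]
          exact hsolf
        · have hsoln : iteratedDeriv 2 (fun τ => pn τ z.2) z.1 - iteratedDeriv 2 (pn z.1) z.2
              + V z.2 * pn z.1 z.2 = 0 := hpn2 z hzn
          show iteratedDeriv 2 (fun τ => g τ z.2) z.1 - iteratedDeriv 2 (g z.1) z.2
              + V z.2 * g z.1 z.2 = 0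
          have e1 : (fun τ => g τ z.2) = fun τ => pn τ z.2 :=
            funext (hg_near z.2 (hxnear z hzn))
          rw [e1, (hg_near_ev z.1 z.2 (hxnear z hzn)).iteratedDeriv_eq,
            hg_near z.2 (hxnear z hzn)]
          exact hsoln
      · -- polynomial in `t` on the cone
        refine ⟨Nf + Nn, fun i x => if x ≤ xc then (if i < Nn then an i x else 0)
          else (if i < Nf then af i x else 0), ?_⟩
        intro z hz
        rcases hfar_of_mem z hz with hzf | hzn
        · have hx := hxfar z hzf
          calc g z.1 z.2 = pf z.1 z.2 := hg_far z.2 hx z.1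
            _ = ∑ i ∈ Finset.range Nf, af i z.2 * z.1 ^ i := hpf3 z hzf
            _ = ∑ i ∈ Finset.range Nf, (if i < Nf then af i z.2 else 0) * z.1 ^ i :=
                Finset.sum_congr rfl fun i hi => by rw [if_pos (Finset.mem_range.1 hi)]
            _ = ∑ i ∈ Finset.range (Nf + Nn), (if i < Nf then af i z.2 else 0) * z.1 ^ i := by
                refine Finset.sum_subset (Finset.range_subset_range.2 (Nat.le_add_right _ _)) ?_
                intro i _ hi
                rw [if_neg (fun h => hi (Finset.mem_range.2 h)), zero_mul]
            _ = _ := Finset.sum_congr rfl fun i _ => by simp only [if_neg (not_le.2 hx)]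
        · have hx := hxnear z hzn
          calc g z.1 z.2 = pn z.1 z.2 := hg_near z.2 hx z.1
            _ = ∑ i ∈ Finset.range Nn, an i z.2 * z.1 ^ i := hpn3 z hzn
            _ = ∑ i ∈ Finset.range Nn, (if i < Nn then an i z.2 else 0) * z.1 ^ i :=
                Finset.sum_congr rfl fun i hi => by rw [if_pos (Finset.mem_range.1 hi)]
            _ = ∑ i ∈ Finset.range (Nf + Nn), (if i < Nn then an i z.2 else 0) * z.1 ^ i := by
                refine Finset.sum_subset (Finset.range_subset_range.2 (Nat.le_add_left _ _)) ?_
                intro i _ hi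
                rw [if_neg (fun h => hi (Finset.mem_range.2 h)), zero_mul]
            _ = _ := Finset.sum_congr rfl fun i _ => by simp only [if_pos hx.le]
    -- the initial deviation energy of the glued element splits
    have hIg : I g = If pf + In pn := by
      have hfar_int : EqOn (fun x => ENNReal.ofReal (energyDensity V (fun t y => ψ t y - g t y) 0 x))
          (fun x => ENNReal.ofReal (energyDensity V (fun t y => ψ t y - pf t y) 0 x))
          (Ioi (xc + ρ)) := by
        intro x hx
        have hx' : xc < x := by have h : xc + ρ < x := hx; linarith
        show ENNReal.ofReal (deriv (fun τ => ψ τ x - g τ x) 0 ^ 2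
            + deriv (fun y => ψ 0 y - g 0 y) x ^ 2 + V x * (ψ 0 x - g 0 x) ^ 2)
          = ENNReal.ofReal (deriv (fun τ => ψ τ x - pf τ x) 0 ^ 2
            + deriv (fun y => ψ 0 y - pf 0 y) x ^ 2 + V x * (ψ 0 x - pf 0 x) ^ 2)
        have e1 : (fun τ => ψ τ x - g τ x) = fun τ => ψ τ x - pf τ x :=
          funext fun τ => by rw [hg_far x hx' τ]
        have e2 : (fun y => ψ 0 y - g 0 y) =ᶠ[𝓝 x] fun y => ψ 0 y - pf 0 y :=
          (hg_far_ev 0 x hx').mono fun y hy => by simp only [hy]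
        rw [e1, e2.deriv_eq, hg_far x hx' 0]
      have hnear_int : EqOn (fun x => ENNReal.ofReal (energyDensity V (fun t y => ψ t y - g t y) 0 x))
          (fun x => ENNReal.ofReal (energyDensity V (fun t y => ψ t y - pn t y) 0 x))
          (Iio (xc - ρ)) := by
        intro x hx
        have hx' : x < xc := by have h : x < xc - ρ := hx; linarith
        show ENNReal.ofReal (deriv (fun τ => ψ τ x - g τ x) 0 ^ 2
            + deriv (fun y => ψ 0 y - g 0 y) x ^ 2 + V x * (ψ 0 x - g 0 x) ^ 2)
          = ENNReal.ofReal (deriv (fun τ => ψ τ x - pn τ x) 0 ^ 2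
            + deriv (fun y => ψ 0 y - pn 0 y) x ^ 2 + V x * (ψ 0 x - pn 0 x) ^ 2)
        have e1 : (fun τ => ψ τ x - g τ x) = fun τ => ψ τ x - pn τ x :=
          funext fun τ => by rw [hg_near x hx' τ]
        have e2 : (fun y => ψ 0 y - g 0 y) =ᶠ[𝓝 x] fun y => ψ 0 y - pn 0 y :=
          (hg_near_ev 0 x hx').mono fun y hy => by simp only [hy]
        rw [e1, e2.deriv_eq, hg_near x hx' 0]
      show (∫⁻ x in {x : ℝ | ρ < |x - xc|},
          ENNReal.ofReal (energyDensity V (fun t y => ψ t y - g t y) 0 x)) = If pf + In pn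
      rw [hsplit ρ hρ0, lintegral_union measurableSet_Iio (hdisj ρ hρ0),
        setLIntegral_congr_fun measurableSet_Ioi hfar_int,
        setLIntegral_congr_fun measurableSet_Iio hnear_int]
    calc (⨅ p ∈ rwKernel V xc ρ, I p) ≤ I g := biInf_le I hgP
      _ = If pf + In pn := hIg
  -- (D) assemble
  show ENNReal.ofReal (min cn cf) * (⨅ p ∈ rwKernel V xc ρ, I p)
    ≤ liminf (exteriorEnergy V xc ρ ψ) atTop + liminf (exteriorEnergy V xc ρ ψ) atBot
  calc ENNReal.ofReal (min cn cf) * (⨅ p ∈ rwKernel V xc ρ, I p)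
      ≤ ENNReal.ofReal (min cn cf) * ((⨅ p ∈ Pf, If p) + (⨅ p ∈ Pn, In p)) := by gcongr
    _ = ENNReal.ofReal (min cn cf) * (⨅ p ∈ Pf, If p)
        + ENNReal.ofReal (min cn cf) * (⨅ p ∈ Pn, In p) := mul_add _ _ _
    _ ≤ ENNReal.ofReal cf * (⨅ p ∈ Pf, If p) + ENNReal.ofReal cn * (⨅ p ∈ Pn, In p) := by
        gcongr
        · exact min_le_right _ _
        · exact min_le_left _ _
    _ ≤ (liminf Ef atTop + liminf Ef atBot) + (liminf En atTop + liminf En atBot) := add_le_add HF HN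
    _ = (liminf Ef atTop + liminf En atTop) + (liminf Ef atBot + liminf En atBot) :=
        add_add_add_comm _ _ _ _
    _ ≤ liminf (exteriorEnergy V xc ρ ψ) atTop + liminf (exteriorEnergy V xc ρ ψ) atBot :=
        add_le_add htop hbot

end Summit.FinalStateConjecture.FinalStateConjecture.Theorems.UniformRClosing
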